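import Literature.Topology.FourManifolds.SmoothSchoenfliesFiveLeCap
import HarnessLib

/-!
# The smooth Schoenflies theorem in dimensions `≥ 5` from Prop. A and the diffeomorphism clause
# of Prop. B (`n = 5`)

Topic `Literature/Topology/FourManifolds`, appendix to `SmoothSchoenfliesFiveLeCap.lean` (fact seat
of `Literature.Topology.FourManifolds.exists_diffeomorph_image_eq_sphereEquator_of_five_le`,
Milnor, *Lectures on the h-cobordism theorem* (1965), §9, Prop. D).  **Everything here is proved;
no named fact is introduced.**

In the printed proof of Prop. C(1) (p. 112; held copy PDF p. 59) the closed `5`-manifold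
`M = W ∪ₕ D⁵` — here the cap `SphereHypersurfaceSides.TubeData.Cap` of a closed side `W` of a
smoothly embedded `S⁴ ⊆ S⁵` — is identified with `S⁵` by the words *"In B) we proved that `M` is
actually diffeomorphic to `S⁵`"*, i.e. by the **second sentence of Prop. B** ("If `n = 5` or `6`,
`Mⁿ` is diffeomorphic to `Sⁿ`" for a closed simply connected smooth homology `n`-sphere), which
the tree vendors as the named fact
`Literature.Topology.FourManifolds.nonempty_diffeomorph_sphere_of_homologySphere_five_six`
(`SmaleHomologySpheres.lean`).  `SmoothSchoenfliesFiveLeCap.lean` went through Milnor's proof of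
that sentence (Kervaire–Milnor/Wall + Prop. A); this appendix records the assembly through the
sentence itself, which is the weakest interface: the tree proves it from Prop. A and
Kervaire–Milnor/Wall (`nonempty_diffeomorph_sphere_of_homologySphere_five_six_of_propA`,
`SmaleHomologySpheresFiveSix.lean`), from the h-cobordism theorem and `Θ₅ = Θ₆ = 0`
(`SmaleHomologySpheresFiveSixTheta.lean`), etc., so whichever of these lands first discharges the
`n + 1 = 5` branch of the fact.

* `SphereHypersurfaceSides.TubeData.nonempty_diffeomorph_cap_sphere_of_five_six` — GIVEN the
  Prop. B clause at universe `0`, the cap of a side of a smooth `S⁴ ⊆ S⁵` is diffeomorphic to `S⁵`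
  (it is a closed simply connected smooth `5`-manifold with the homology of `S⁵`,
  `SmoothSchoenfliesFiveLeCap.lean` §6);
* `exists_diffeomorph_image_eq_sphereEquator_of_five_le_of_propA_of_cap` — the fact from Prop. A
  and ANY identification of all such caps with `S⁵` (the Palais–Cerf step and the assembly of
  `SmoothSchoenfliesFiveLeCap.lean` §§7–10, abstracted);
* `exists_diffeomorph_image_eq_sphereEquator_of_five_le_of_propA_of_five_six` — **the fact from
  Prop. A and the Prop. B clause** (`n = 5`).

## References

* J. Milnor, *Lectures on the h-cobordism theorem*, Princeton (1965), §9: Prop. B (p. 109; PDF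
  p. 58), Prop. C(1) and its proof, Prop. D (pp. 111–112; PDF p. 59). [MilnorHCobordism1965]
-/

open scoped Manifold ContDiff Topology
open Set Function Metric

noncomputable section

namespace Literature.Topology.FourManifolds

namespace SphereHypersurfaceSides.TubeData

variable {f : sphere (0 : EuclideanSpace ℝ (Fin (4 + 1))) 1 →
  sphere (0 : EuclideanSpace ℝ (Fin (4 + 1 + 1))) 1} (D : TubeData f)

/-- **The cap is diffeomorphic to `S⁵`, GIVEN the diffeomorphism clause of Prop. B** (`n = 5`,
tree fact `nonempty_diffeomorph_sphere_of_homologySphere_five_six`, universe `0`): the cap is a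
closed simply connected smooth `5`-manifold with the integral homology of `S⁵`.  Milnor's
"In B) we proved that `M` is actually diffeomorphic to `S⁵`".
[cite: MilnorHCobordism1965, §9, proof of Prop. C(1) (p. 112; PDF p. 59)] -/
theorem nonempty_diffeomorph_cap_sphere_of_five_six
    (h56 : nonempty_diffeomorph_sphere_of_homologySphere_five_six.{0}) (hm : 1 ≤ 4) :
    Nonempty (D.Cap hm ≃ₘ⟮𝓘(ℝ, EuclideanSpace ℝ (Fin (4 + 1))), 𝓡 (4 + 1)⟯
      sphere (0 : EuclideanSpace ℝ (Fin (4 + 1 + 1))) 1) :=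
  h56 (4 + 1) (Or.inl rfl) (D.Cap hm) (fun _ hk hk5 => D.isZero_singularHomology_cap hm hk hk5)
    (D.nonempty_singularHomology_cap_iso hm)

end SphereHypersurfaceSides.TubeData

/-- **The fact from Prop. A and any identification of the caps with `S⁵`.**  If every cap
`TubeData.Cap` of a closed side of a smoothly embedded `S⁴ ⊆ S⁵` is diffeomorphic to `S⁵`, then
(Palais–Cerf step `TubeData.nonempty_diffeomorph_side_closedBall_of_diffeomorph`, flipped tube,
`RegularSublevel.diffeomorphOfPreimageEq`) every closed side of every side package is
diffeomorphic to `𝔻⁵` — the hypothesis `hC` of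
`exists_diffeomorph_image_eq_sphereEquator_of_five_le_of_propA_of_sides_five` — and with Prop. A
for `n + 1 ≥ 6` the named fact follows.
[cite: MilnorHCobordism1965, §9, proofs of Prop. C(1) and Prop. D (p. 112; PDF p. 59)] -/
theorem exists_diffeomorph_image_eq_sphereEquator_of_five_le_of_propA_of_cap
    (hA : Milnor1965_propA.{0})
    (hcap : ∀ {f : sphere (0 : EuclideanSpace ℝ (Fin (4 + 1))) 1 →
        sphere (0 : EuclideanSpace ℝ (Fin (4 + 1 + 1))) 1}
      (D : SphereHypersurfaceSides.TubeData f) (hm : 1 ≤ 4),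
      Nonempty (D.Cap hm ≃ₘ⟮𝓘(ℝ, EuclideanSpace ℝ (Fin (4 + 1))), 𝓡 (4 + 1)⟯
        sphere (0 : EuclideanSpace ℝ (Fin (4 + 1 + 1))) 1)) :
    exists_diffeomorph_image_eq_sphereEquator_of_five_le := by
  refine exists_diffeomorph_image_eq_sphereEquator_of_five_le_of_propA_of_sides_five hA
    fun K g hg => ?_
  obtain ⟨D⟩ := SphereHypersurfaceSides.nonempty_tubeData (m := 4) K.isSmoothEmbedding
  have hm : (1 : ℕ) ≤ 4 := by norm_num
  rcases D.preimage_Iic_eq_or hm hg with h | h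
  · obtain ⟨Φ⟩ := hcap D hm
    obtain ⟨Ψ⟩ := D.nonempty_diffeomorph_side_closedBall_of_diffeomorph hm Φ
    exact ⟨(RegularSublevel.diffeomorphOfPreimageEq hg.isRegularLevel
      (D.isRegularLevel_sideFun hm) h).trans Ψ⟩
  · obtain ⟨Φ⟩ := hcap D.flip hm
    obtain ⟨Ψ⟩ := D.flip.nonempty_diffeomorph_side_closedBall_of_diffeomorph hm Φ
    exact ⟨(RegularSublevel.diffeomorphOfPreimageEq hg.isRegularLevel
      (D.flip.isRegularLevel_sideFun hm) h).trans Ψ⟩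

/-- **The smooth Schoenflies theorem in dimensions `≥ 5` from Prop. A and the diffeomorphism
clause of Prop. B** (Milnor 1965, §9: Prop. D by "A) and C)", Prop. C(1) by "In B) we proved that
`M` is actually diffeomorphic to `S⁵`"): the named fact
`exists_diffeomorph_image_eq_sphereEquator_of_five_le` follows from `Milnor1965_propA` and
`nonempty_diffeomorph_sphere_of_homologySphere_five_six`, both at universe `0`.
[cite: MilnorHCobordism1965, §9, Prop. B, Prop. C(1), Prop. D and their proofs (pp. 109–112; PDF pp. 58–59)] -/
theorem exists_diffeomorph_image_eq_sphereEquator_of_five_le_of_propA_of_five_six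
    (hA : Milnor1965_propA.{0}) (h56 : nonempty_diffeomorph_sphere_of_homologySphere_five_six.{0}) :
    exists_diffeomorph_image_eq_sphereEquator_of_five_le :=
  exists_diffeomorph_image_eq_sphereEquator_of_five_le_of_propA_of_cap hA
    fun D hm => D.nonempty_diffeomorph_cap_sphere_of_five_six h56 hm

end Literature.Topology.FourManifolds

end
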